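import Summits.HubbardSuperconductivity.HubbardSuperconductivity.Theses.LogColdTorus
import Literature.Barriers.HubbardSuperconductivity.HohenbergMerminWagnerPairing

/-!
# Route `LogColdTorus`, support `LogScaleNecessity` (item `stmt-HubbardSuperconductivity-8812`)

NECESSITY OF THE LOG SCALE: thermal `d`-wave pair order `c·L⁴ ≤ Re⟨Δ_d†Δ_d⟩_{β,L,U,μ}` of the
grand-canonical Gibbs state of `hubbardTorusWith 2 L 1 U μ` forces `β ≥ κ₁ log L` for `L ≥ L₀`,
with `κ₁ > 0`, `L₀` depending only on `c` (and the universal `d`-wave constant `C_g`). This is the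
Hohenberg–Mermin–Wagner–Koma–Tasaki barrier read at its threshold: the proved power-law bound
`|⟨P_x†P_y⟩_{β,L}| ≤ C_g (dist(x,y)+1)^{-f(β)}` (`norm_thermalCorr_localPair_le`, from
`hohenbergMerminWagnerPairing_holds`) with `f(β) ≥ 1/(1 + 128β)`, the row-sum estimate
`Σ_y (dist+1)^{-f} ≤ (2R+1)² + L²(R+1)^{-f}` (`sum_rpow_torusDist_le`) at `R = ⌊√L⌋`, and the
arithmetic `L^{-f/2} ≤ e^{-K}` once `β < log L/(512 K)` and `log L ≥ 4K`, `K = max(1, log(8C_g/c))`.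

Sources: T. Koma, H. Tasaki, PRL 68 (1992) 3248 (Theorem, eq. (2), p. 3); G. Su, M. Suzuki,
PRB 58 (1998) 117; O. McBryan, T. Spencer, CMP 53 (1977) 299.
-/

set_option linter.dupNamespace false

noncomputable section

namespace Summit.HubbardSuperconductivity.HubbardSuperconductivity.Theorems.LogColdTorus

open Matrix Finset Literature.MathematicalPhysics.QuantumLattice Literature.Probability.LatticeModels
open Literature.Barriers.HubbardSuperconductivity
open Summit.HubbardSuperconductivity.HubbardSuperconductivity.Theses.LogColdTorus

/-- `⟨Δ_g† Δ_g⟩_β = Σ_{x,y} ⟨P_x† P_y⟩_β` for the Gibbs state (bilinearity).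
Scalapino, Phys. Rep. 250 (1995) 329, §2. [folklore] -/
theorem gibbsState_pairField_conjTranspose_mul {n : ℕ} [NeZero n] (g : Site 2 → ℝ) (β : ℝ)
    (H : Matrix (Finset (Orb (FermionTorus 2 n))) (Finset (Orb (FermionTorus 2 n))) ℂ) :
    H.gibbsState β ((pairField g n)ᴴ * pairField g n) =
      ∑ x : TorusSite 2 n, ∑ y : TorusSite 2 n, H.thermalCorr β (localPair g n x)ᴴ (localPair g n y) := by
  rw [pairField, conjTranspose_sum, Finset.sum_mul]
  simp only [Finset.mul_sum, map_sum, Matrix.thermalCorr]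

/-- The decay exponent dominates `1/(1 + 128 b)`: `(2 + 128b)/(1 + 128b)² ≥ 1/(1 + 128b)` for
`b ≥ 0`. [cite: KomaTasakiPRL1992, Theorem] -/
theorem inv_le_pairDecayExponent {b : ℝ} (hb : 0 ≤ b) :
    1 / (1 + 128 * b) ≤ pairDecayExponent b := by
  unfold pairDecayExponent
  rw [div_le_div_iff₀ (by positivity) (by positivity)]
  nlinarith

/-- **Thermal pair order is at most `9 C_g L³ + C_g L^{4 - f/2}`-ish**: for `β ≥ 0`, `L ≥ 1` and
the Koma–Tasaki exponent `f = pairDecayExponent β`,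
`Re⟨Δ_d†Δ_d⟩_{β,L} ≤ C_g · L² · (9L + L² · (√L)^{-f})` (decay bound summed with cut-off radius
`R = ⌊√L⌋`). [cite: KomaTasakiPRL1992, Theorem eq. (2) and remark after it] -/
theorem re_gibbsState_pairField_le (U μ : ℝ) {β : ℝ} (hβ : 0 ≤ β) (L : ℕ) [NeZero L] :
    ((hubbardTorusWith 2 L 1 U μ).gibbsState β
        ((pairField dWaveFormFactor L)ᴴ * pairField dWaveFormFactor L)).re ≤
      pairFieldDecayConst dWaveFormFactor * ((L : ℝ) ^ 2 *
        (9 * (L : ℝ) + (L : ℝ) ^ 2 * (Real.sqrt L) ^ (-pairDecayExponent (β * |(1 : ℝ)|)))) := by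
  set C : ℝ := pairFieldDecayConst dWaveFormFactor with hC
  set f : ℝ := pairDecayExponent (β * |(1 : ℝ)|) with hf
  have hC0 : 0 ≤ C := pairFieldDecayConst_nonneg _
  have hf0 : 0 < f := pairDecayExponent_pos (by positivity)
  have hL1 : (1 : ℝ) ≤ (L : ℝ) := by exact_mod_cast NeZero.one_le
  have hsq1 : 1 ≤ Real.sqrt L := by rw [← Real.sqrt_one]; exact Real.sqrt_le_sqrt hL1
  have hsq0 : 0 < Real.sqrt L := by linarith
  -- cut-off radius
  set R : ℕ := ⌊Real.sqrt L⌋₊ with hR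
  have hRle : (R : ℝ) ≤ Real.sqrt L := Nat.floor_le hsq0.le
  have hRlt : Real.sqrt L < (R : ℝ) + 1 := Nat.lt_floor_add_one _
  -- row sums
  have hrow : ∀ x : TorusSite 2 L,
      ∑ y : TorusSite 2 L, ((torusDist x y : ℝ) + 1) ^ (-f) ≤
        9 * (L : ℝ) + (L : ℝ) ^ 2 * (Real.sqrt L) ^ (-f) := by
    intro x
    refine (sum_rpow_torusDist_le L x hf0.le R).trans ?_
    have h1 : (2 * R + 1 : ℝ) ^ 2 ≤ 9 * (L : ℝ) := by
      have : (2 * R + 1 : ℝ) ≤ 3 * Real.sqrt L := by linarith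
      calc (2 * R + 1 : ℝ) ^ 2 ≤ (3 * Real.sqrt L) ^ 2 := by gcongr
        _ = 9 * (L : ℝ) := by
            rw [mul_pow, Real.sq_sqrt (by positivity)]; norm_num
    have h2 : ((R : ℝ) + 1) ^ (-f) ≤ (Real.sqrt L) ^ (-f) :=
      Real.rpow_le_rpow_of_nonpos hsq0 hRlt.le (by linarith)
    have h3 : (L : ℝ) ^ 2 * ((R : ℝ) + 1) ^ (-f) ≤ (L : ℝ) ^ 2 * (Real.sqrt L) ^ (-f) :=
      mul_le_mul_of_nonneg_left h2 (by positivity)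
    linarith [h1, h3]
  -- the double sum
  have hcard : (Fintype.card (TorusSite 2 L) : ℝ) = (L : ℝ) ^ 2 := by
    simp only [Fintype.card_pi, ZMod.card, Finset.prod_const, Finset.card_univ, Fintype.card_fin]
    push_cast
    rfl
  have hdouble : ∑ x : TorusSite 2 L, ∑ y : TorusSite 2 L, ((torusDist x y : ℝ) + 1) ^ (-f) ≤
      (L : ℝ) ^ 2 * (9 * (L : ℝ) + (L : ℝ) ^ 2 * (Real.sqrt L) ^ (-f)) := by
    calc ∑ x : TorusSite 2 L, ∑ y : TorusSite 2 L, ((torusDist x y : ℝ) + 1) ^ (-f)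
        ≤ ∑ _x : TorusSite 2 L, (9 * (L : ℝ) + (L : ℝ) ^ 2 * (Real.sqrt L) ^ (-f)) :=
          Finset.sum_le_sum fun x _ => hrow x
      _ = (L : ℝ) ^ 2 * (9 * (L : ℝ) + (L : ℝ) ^ 2 * (Real.sqrt L) ^ (-f)) := by
          rw [Finset.sum_const, nsmul_eq_mul, Finset.card_univ, hcard]
  -- the decay bound, term by term
  rw [gibbsState_pairField_conjTranspose_mul, Complex.re_sum]
  calc ∑ x : TorusSite 2 L, (∑ y : TorusSite 2 L, (hubbardTorusWith 2 L 1 U μ).thermalCorr β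
          (localPair dWaveFormFactor L x)ᴴ (localPair dWaveFormFactor L y)).re
      ≤ ∑ x : TorusSite 2 L, ∑ y : TorusSite 2 L, C * ((torusDist x y : ℝ) + 1) ^ (-f) := by
        refine Finset.sum_le_sum fun x _ => ?_
        rw [Complex.re_sum]
        refine Finset.sum_le_sum fun y _ => ?_
        exact (Complex.re_le_norm _).trans
          (norm_thermalCorr_localPair_le dWaveFormFactor 1 U μ hβ x y)
    _ = C * ∑ x : TorusSite 2 L, ∑ y : TorusSite 2 L, ((torusDist x y : ℝ) + 1) ^ (-f) := by
        rw [Finset.mul_sum]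
        refine Finset.sum_congr rfl fun x _ => ?_
        rw [Finset.mul_sum]
    _ ≤ C * ((L : ℝ) ^ 2 * (9 * (L : ℝ) + (L : ℝ) ^ 2 * (Real.sqrt L) ^ (-f))) :=
        mul_le_mul_of_nonneg_left hdouble hC0

/-- **`LogScaleNecessity` holds** (route `LogColdTorus`, support item
`stmt-HubbardSuperconductivity-8812`): for all `U, μ` and `c > 0` there are `κ₁ > 0` and `L₀` such
that for `L ≥ L₀` and `β ≥ 0`, thermal `d`-wave order `c·L⁴ ≤ Re⟨Δ_d†Δ_d⟩_{β,L,U,μ}` forces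
`κ₁ log L ≤ β`. Constants: `κ₁ = 1/(512K)`, `K = max(1, log(8C_g/c))`, `L₀ > max(e^{4K}, 32C_g/c)`.
Koma–Tasaki (1992), Theorem and p. 3 ("the power indices are proportional to β⁻¹"). -/
theorem logScaleNecessity_proof : LogScaleNecessity := by
  intro U μ c hc
  set C : ℝ := pairFieldDecayConst dWaveFormFactor with hC
  have hC0 : 0 ≤ C := pairFieldDecayConst_nonneg _
  set K : ℝ := max 1 (Real.log (8 * C / c)) with hK
  have hK1 : 1 ≤ K := le_max_left _ _
  have hK0 : 0 < K := by linarith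
  -- `C e^{-K} ≤ c/8`
  have hCK : C * Real.exp (-K) ≤ c / 8 := by
    rcases hC0.eq_or_lt with h0 | hCpos
    · rw [← h0, zero_mul]; positivity
    · have h8 : 0 < 8 * C / c := by positivity
      have : Real.exp (-K) ≤ c / (8 * C) := by
        calc Real.exp (-K) ≤ Real.exp (-Real.log (8 * C / c)) :=
              Real.exp_le_exp.mpr (neg_le_neg (le_max_right _ _))
          _ = c / (8 * C) := by rw [Real.exp_neg, Real.exp_log h8, inv_div]
      calc C * Real.exp (-K) ≤ C * (c / (8 * C)) := mul_le_mul_of_nonneg_left this hC0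
        _ = c / 8 := by field_simp
  refine ⟨1 / (512 * K), by positivity, ?_⟩
  obtain ⟨L₀, hL₀⟩ := exists_nat_gt (max (Real.exp (4 * K)) (32 * C / c))
  refine ⟨L₀, fun L _ hL β hβ hord => ?_⟩
  have hL₀' : (L₀ : ℝ) ≤ (L : ℝ) := by exact_mod_cast hL
  have hLexp : Real.exp (4 * K) < (L : ℝ) := (le_max_left _ _).trans_lt (hL₀.trans_le hL₀')
  have hLC : 32 * C / c < (L : ℝ) := (le_max_right _ _).trans_lt (hL₀.trans_le hL₀')
  have hLpos : (0 : ℝ) < (L : ℝ) := (Real.exp_pos _).trans hLexp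
  have hlog : 4 * K < Real.log L := by
    rw [Real.lt_log_iff_exp_lt hLpos]; exact hLexp
  by_contra hlt
  push Not at hlt
  -- the exponent
  set f : ℝ := pairDecayExponent (β * |(1 : ℝ)|) with hf
  have hβ1 : β * |(1 : ℝ)| = β := by rw [abs_one, mul_one]
  have hf0 : 0 < f := pairDecayExponent_pos (by positivity)
  have hfl : 1 / (1 + 128 * β) ≤ f := by
    rw [hf, hβ1]; exact inv_le_pairDecayExponent hβ
  -- `f · log L ≥ 2K`
  have hlogpos : 0 < Real.log L := by linarith
  have hkey : 2 * K ≤ f * Real.log L := by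
    by_contra hcon
    push Not at hcon
    have hden : 0 < 1 + 128 * β := by positivity
    have e1 : 1 / (1 + 128 * β) * (Real.log L * (1 + 128 * β)) = Real.log L := by
      rw [div_mul_eq_mul_div, one_mul, mul_div_assoc, div_self hden.ne', mul_one]
    have h1 : Real.log L ≤ f * Real.log L * (1 + 128 * β) := by
      have := mul_le_mul_of_nonneg_right hfl (mul_pos hlogpos hden).le
      rw [e1] at this
      linarith
    have h2 : f * Real.log L * (1 + 128 * β) < 2 * K * (1 + 128 * β) :=
      mul_lt_mul_of_pos_right hcon hden
    have e2 : 256 * K * (1 / (512 * K) * Real.log L) = Real.log L / 2 := by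
      field_simp; ring
    have h3 := mul_lt_mul_of_pos_left hlt (by positivity : (0 : ℝ) < 256 * K)
    rw [e2] at h3
    linarith
  -- `(√L)^{-f} ≤ e^{-K}`
  have hsqrt : (Real.sqrt L) ^ (-f) ≤ Real.exp (-K) := by
    rw [Real.rpow_def_of_pos (Real.sqrt_pos.mpr hLpos), Real.log_sqrt hLpos.le]
    refine Real.exp_le_exp.mpr ?_
    have : Real.log L / 2 * -f = -(f * Real.log L) / 2 := by ring
    rw [this]
    linarith
  -- assemble
  have hmain := re_gibbsState_pairField_le U μ hβ L
  rw [← hC, ← hf] at hmain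
  have hL4 : c * (L : ℝ) ^ 4 ≤ C * ((L : ℝ) ^ 2 * (9 * (L : ℝ) + (L : ℝ) ^ 2 * (Real.sqrt L) ^ (-f))) :=
    hord.trans hmain
  have hT2 : C * ((L : ℝ) ^ 2 * ((L : ℝ) ^ 2 * (Real.sqrt L) ^ (-f))) ≤ c / 8 * (L : ℝ) ^ 4 := by
    calc C * ((L : ℝ) ^ 2 * ((L : ℝ) ^ 2 * (Real.sqrt L) ^ (-f)))
        = (C * (Real.sqrt L) ^ (-f)) * (L : ℝ) ^ 4 := by ring
      _ ≤ (C * Real.exp (-K)) * (L : ℝ) ^ 4 :=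
          mul_le_mul_of_nonneg_right (mul_le_mul_of_nonneg_left hsqrt hC0) (by positivity)
      _ ≤ c / 8 * (L : ℝ) ^ 4 := mul_le_mul_of_nonneg_right hCK (by positivity)
  have hT1 : C * ((L : ℝ) ^ 2 * (9 * (L : ℝ))) < 7 * c / 8 * (L : ℝ) ^ 4 := by
    have hL3 : (0 : ℝ) < (L : ℝ) ^ 3 := by positivity
    have h72 : 9 * C < 7 * c / 8 * (L : ℝ) := by
      have : 32 * C < c * (L : ℝ) := by
        have := (div_lt_iff₀ hc).mp hLC; linarith
      nlinarith
    calc C * ((L : ℝ) ^ 2 * (9 * (L : ℝ))) = 9 * C * (L : ℝ) ^ 3 := by ring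
      _ < 7 * c / 8 * (L : ℝ) * (L : ℝ) ^ 3 := mul_lt_mul_of_pos_right h72 hL3
      _ = 7 * c / 8 * (L : ℝ) ^ 4 := by ring
  have : C * ((L : ℝ) ^ 2 * (9 * (L : ℝ) + (L : ℝ) ^ 2 * (Real.sqrt L) ^ (-f))) < c * (L : ℝ) ^ 4 := by
    rw [mul_add, mul_add]
    linarith
  linarith
end Summit.HubbardSuperconductivity.HubbardSuperconductivity.Theorems.LogColdTorus
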